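import Summits.Schanuel.Schanuel.Theorems.RootDecomp1BNesterenkoRadical02

/-!
# RootDecomp1BNesterenkoRadical — lens 4, generation 33 «NESTERENKO-BASE RADICAL DESCENT» (NesterenkoRadical.lean 10da44fa…, 870 l) — continuation (RootDecomp1BNesterenkoRadical03): §C the cells at `(π, ρπ)` / `(ρπ, π)`, ρ ultra-Liouville (mod h52): flag data, separation (`not_liouville_pi`, `not_ultraLiouville_pi`, `range_pi_smul_pi_ne_storey_one`, `pi_smul_pi_ne_algebraic_line`), step cells, flagship, density, the member at ρ_U, the X ⟹ cell shape check

(lens-4 g33 `NesterenkoRadical.lean`, sha256 10da44fa…3eea, own farm rc 0 · 0 sorry · axioms std; critic VERDICT STATUS L1718 PORT GO LOW; port by census-1 gen 15 in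
three parts `RootDecomp1BNesterenkoRadical01`–`03` — see the PORT NOTE of part 01; `--supports stmt-Schanuel-24622`; rung 0.)
-/

noncomputable section

open Complex

namespace Summit.Schanuel.Schanuel.Theorems.RootDecomp1BNesterenkoRadical

open Summit.Schanuel.Schanuel.Theorems.RootDecomp1BRadicalDescent

/-! ## §C  The cells at `r = (π, ρπ)` and `r' = (ρπ, π)`, `ρ` ultra-Liouville -/

section Cells

open Summit.Schanuel.Schanuel.Theorems.RootDecomp1BFedFlagCore (KleinIH polarDeg polarField baseField IsFed LastFed
  coe_mem_polarField exp_coe_mem_polarField exp_coe_mul_I_mem_polarField coe_mul_I_mem_polarField coord_mem_span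
  isFed_of_isAlgebraic_base_exp_coord_mul_I)
open Summit.Schanuel.Schanuel.Theorems.RootDecomp1BTameFlagCore (IsWild IsTame LastTame HasSharpHyperplane
  lastTame_of_lastFed isTame_of_isFed isWild_iff_not_isTame)
open Summit.Schanuel.Schanuel.Theorems.RootDecomp1BDefectFloorDefs (SharpRelativeLindemannAt TameDefectZeroAt
  WildSharpDefectZeroAt WildSharpDefectZeroInitAt)
open Summit.Schanuel.Schanuel.Theorems.RootDecomp1BDefectFloorCells (natCast_le_trdeg_of_algebraicIndependent
  isAlgebraic_exp_pi_mul_I polarDeg_pi_le_two)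
open Literature.Barriers.Schanuel (NesterenkoPhilippon2001_ch3_cor_5_2)

/-- **THE STOREY-TWO TUPLE OVER `π` (`ρ > 0`).** `e^{ρπ}, ρ, π, e^{π}, Γ(1/4)` are algebraically independent over `ℚ`
for every ultra-Liouville `ρ > 0` (mod Cor. 5.2: base `θ = (π, e^π, Γ(1/4))`, `i₀ ↦ e^π`, `y₀ = π`). -/
theorem algebraicIndependent_five_pi_of_pos (h52 : NesterenkoPhilippon2001_ch3_cor_5_2) {ρ : ℝ}
    (hρ : UltraLiouville ρ) (hρ0 : 0 < ρ) :
    AlgebraicIndependent ℚ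
      (Fin.cons (cexp ((ρ : ℂ) * (Real.pi : ℂ))) (Fin.cons (ρ : ℂ)
        ![(Real.pi : ℂ), cexp (Real.pi : ℂ), (Real.Gamma (1 / 4) : ℂ)]) : Fin (3 + 2) → ℂ) :=
  algebraicIndependent_radical_of_polySizeMeasure (polySizeMeasure_piTriple h52) 1 (by simp) hρ hρ0

/-- The four of them that live in the polar field: `e^{ρπ}, ρ, π, e^{π}` algebraically independent (`ρ > 0` ultra). -/
theorem algebraicIndependent_four_pi_of_pos (h52 : NesterenkoPhilippon2001_ch3_cor_5_2) {ρ : ℝ}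
    (hρ : UltraLiouville ρ) (hρ0 : 0 < ρ) :
    AlgebraicIndependent ℚ ![cexp ((ρ : ℂ) * (Real.pi : ℂ)), (ρ : ℂ), (Real.pi : ℂ), cexp (Real.pi : ℂ)] := by
  have h := (algebraicIndependent_five_pi_of_pos h52 hρ hρ0).comp (Fin.castLE (show 4 ≤ 3 + 2 by norm_num))
    (Fin.castLE_injective _)
  convert h using 1
  funext i
  fin_cases i <;> rfl

/-- `t ≥ 4` for ANY subfield containing `π, e^π, ρ, e^{ρπ}` (`ρ` ultra-Liouville, either sign). -/
theorem four_le_trdeg_of_mem (h52 : NesterenkoPhilippon2001_ch3_cor_5_2) {ρ : ℝ} (hρ : UltraLiouville ρ)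
    {L : IntermediateField ℚ ℂ} (hπ : (Real.pi : ℂ) ∈ L) (he : cexp (Real.pi : ℂ) ∈ L) (hρm : (ρ : ℂ) ∈ L)
    (heρ : cexp ((ρ : ℂ) * (Real.pi : ℂ)) ∈ L) : ((2 + 2 : ℕ) : Cardinal) ≤ Algebra.trdeg ℚ ↥L := by
  have hρne : ρ ≠ 0 := fun h => hρ.irrational ⟨0, by simp [h]⟩
  rcases lt_or_gt_of_ne hρne with hneg | hpos
  · have hai := algebraicIndependent_four_pi_of_pos h52 hρ.neg (neg_pos.2 hneg)
    refine natCast_le_trdeg_of_algebraicIndependent hai fun i => ?_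
    fin_cases i
    · show cexp ((((-ρ : ℝ)) : ℂ) * (Real.pi : ℂ)) ∈ L
      rw [Complex.ofReal_neg, neg_mul, Complex.exp_neg]
      exact inv_mem heρ
    · show (((-ρ : ℝ)) : ℂ) ∈ L
      rw [Complex.ofReal_neg]
      exact neg_mem hρm
    · exact hπ
    · exact he
  · have hai := algebraicIndependent_four_pi_of_pos h52 hρ hpos
    refine natCast_le_trdeg_of_algebraicIndependent hai fun i => ?_
    fin_cases i
    · exact heρ
    · exact hρm
    · exact hπ
    · exact he

/-- `(π, ρπ)` is `ℚ`-free for irrational `ρ` (hypothesis-free). -/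
theorem linearIndependent_pi_smul_pi {ρ : ℝ} (hρ : Irrational ρ) :
    LinearIndependent ℚ ![Real.pi, ρ * Real.pi] := by
  rw [LinearIndependent.pair_iff]
  intro s t h
  rw [Rat.smul_def, Rat.smul_def] at h
  have h' : ((s : ℝ) + t * ρ) * Real.pi = 0 := by linear_combination h
  have h2 : (s : ℝ) + t * ρ = 0 := (mul_eq_zero.1 h').resolve_right Real.pi_ne_zero
  by_cases ht : t = 0
  · rw [ht, Rat.cast_zero, zero_mul, add_zero] at h2
    exact ⟨by exact_mod_cast h2, ht⟩
  · exfalso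
    refine hρ ⟨-s / t, ?_⟩
    have ht' : ((t : ℚ) : ℝ) ≠ 0 := by exact_mod_cast ht
    push_cast
    field_simp
    linarith

/-- `(ρπ, π)` is `ℚ`-free for irrational `ρ` (hypothesis-free). -/
theorem linearIndependent_smul_pi_pi {ρ : ℝ} (hρ : Irrational ρ) :
    LinearIndependent ℚ ![ρ * Real.pi, Real.pi] := by
  rw [LinearIndependent.pair_iff]
  intro s t h
  have h' := (LinearIndependent.pair_iff.1 (linearIndependent_pi_smul_pi hρ)) t s (by rw [add_comm]; exact h)
  exact ⟨h'.2, h'.1⟩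

/-- **X(2)(π, ρπ): `t(π, ρπ) ≥ 4 = m + m` (`m = 2`)** for EVERY ultra-Liouville `ρ` (mod Cor. 5.2). -/
theorem four_le_polarDeg_pi_ultra (h52 : NesterenkoPhilippon2001_ch3_cor_5_2) {ρ : ℝ} (hρ : UltraLiouville ρ) :
    ((2 + 2 : ℕ) : Cardinal) ≤ polarDeg ![Real.pi, ρ * Real.pi] := by
  have hπ : (Real.pi : ℂ) ∈ polarField ![Real.pi, ρ * Real.pi] := by
    simpa using coe_mem_polarField ![Real.pi, ρ * Real.pi] 0
  have he : cexp (Real.pi : ℂ) ∈ polarField ![Real.pi, ρ * Real.pi] := by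
    simpa using exp_coe_mem_polarField ![Real.pi, ρ * Real.pi] 0
  have hρπ : (ρ : ℂ) * (Real.pi : ℂ) ∈ polarField ![Real.pi, ρ * Real.pi] := by
    simpa using coe_mem_polarField ![Real.pi, ρ * Real.pi] 1
  have heρ : cexp ((ρ : ℂ) * (Real.pi : ℂ)) ∈ polarField ![Real.pi, ρ * Real.pi] := by
    simpa using exp_coe_mem_polarField ![Real.pi, ρ * Real.pi] 1
  have hπ0 : (Real.pi : ℂ) ≠ 0 := Complex.ofReal_ne_zero.mpr Real.pi_ne_zero
  have hρm : (ρ : ℂ) ∈ polarField ![Real.pi, ρ * Real.pi] := by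
    have := div_mem hρπ hπ
    rwa [mul_div_cancel_right₀ _ hπ0] at this
  exact four_le_trdeg_of_mem h52 hρ hπ he hρm heρ

/-- The same at the RE-BASED tuple `(ρπ | π)` (tame direction last). -/
theorem four_le_polarDeg_smul_pi_pi_ultra (h52 : NesterenkoPhilippon2001_ch3_cor_5_2) {ρ : ℝ}
    (hρ : UltraLiouville ρ) : ((2 + 2 : ℕ) : Cardinal) ≤ polarDeg ![ρ * Real.pi, Real.pi] := by
  have hπ : (Real.pi : ℂ) ∈ polarField ![ρ * Real.pi, Real.pi] := by
    simpa using coe_mem_polarField ![ρ * Real.pi, Real.pi] 1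
  have he : cexp (Real.pi : ℂ) ∈ polarField ![ρ * Real.pi, Real.pi] := by
    simpa using exp_coe_mem_polarField ![ρ * Real.pi, Real.pi] 1
  have hρπ : (ρ : ℂ) * (Real.pi : ℂ) ∈ polarField ![ρ * Real.pi, Real.pi] := by
    simpa using coe_mem_polarField ![ρ * Real.pi, Real.pi] 0
  have heρ : cexp ((ρ : ℂ) * (Real.pi : ℂ)) ∈ polarField ![ρ * Real.pi, Real.pi] := by
    simpa using exp_coe_mem_polarField ![ρ * Real.pi, Real.pi] 0
  have hπ0 : (Real.pi : ℂ) ≠ 0 := Complex.ofReal_ne_zero.mpr Real.pi_ne_zero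
  have hρm : (ρ : ℂ) ∈ polarField ![ρ * Real.pi, Real.pi] := by
    have := div_mem hρπ hπ
    rwa [mul_div_cancel_right₀ _ hπ0] at this
  exact four_le_trdeg_of_mem h52 hρ hπ he hρm heρ

/-- The same in the VERBATIM shape of the body of the 1B crux `KleinPolarSchanuel` (item 24622) at `m = 2`,
`r = (π, ρπ)` (`polarDeg` unfolded) — equivalently Schanuel's conjecture for the ℚ-free 4-tuple `z = (π, ρπ, iπ, iρπ)`. -/
theorem kleinPolarSchanuel_body_two_pi_ultra (h52 : NesterenkoPhilippon2001_ch3_cor_5_2) {ρ : ℝ}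
    (hρ : UltraLiouville ρ) :
    ((2 + 2 : ℕ) : Cardinal) ≤ Algebra.trdeg ℚ ↥(IntermediateField.adjoin ℚ
      (Set.range (Fin.append (fun j => ((![Real.pi, ρ * Real.pi] j : ℝ) : ℂ))
          (fun j => ((![Real.pi, ρ * Real.pi] j : ℝ) : ℂ) * Complex.I)) ∪
        Set.range (Complex.exp ∘ Fin.append (fun j => ((![Real.pi, ρ * Real.pi] j : ℝ) : ℂ))
          (fun j => ((![Real.pi, ρ * Real.pi] j : ℝ) : ℂ) * Complex.I)))) :=
  four_le_polarDeg_pi_ultra h52 hρ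

/-- `t(π, ρπ) ≥ 3` (the floor, for the SRL step instance). -/
theorem three_le_polarDeg_pi_ultra (h52 : NesterenkoPhilippon2001_ch3_cor_5_2) {ρ : ℝ} (hρ : UltraLiouville ρ) :
    ((1 + 1 + 1 : ℕ) : Cardinal) ≤ polarDeg ![Real.pi, ρ * Real.pi] :=
  (Nat.cast_le.2 (by norm_num)).trans (four_le_polarDeg_pi_ultra h52 hρ)

/-- `t(ρπ, π) ≥ 3`. -/
theorem three_le_polarDeg_smul_pi_pi_ultra (h52 : NesterenkoPhilippon2001_ch3_cor_5_2) {ρ : ℝ}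
    (hρ : UltraLiouville ρ) : ((1 + 1 + 1 : ℕ) : Cardinal) ≤ polarDeg ![ρ * Real.pi, Real.pi] :=
  (Nat.cast_le.2 (by norm_num)).trans (four_le_polarDeg_smul_pi_pi_ultra h52 hρ)

/-! ### Flag data of the tuples (all hypothesis-free) -/

/-- The last coordinate `π` of `(ρπ | π)` is FED: `e^{iπ} = −1` is algebraic over the base field. -/
theorem lastFed_smul_pi_pi (ρ : ℝ) : LastFed 1 ![ρ * Real.pi, Real.pi] := by
  right
  have hlast : (![ρ * Real.pi, Real.pi] : Fin 2 → ℝ) (Fin.last 1) = Real.pi := rfl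
  rw [hlast]
  exact isAlgebraic_exp_pi_mul_I.tower_top _

/-- … hence TAME at the last coordinate (`LastTame`, the structural hypothesis of T0). -/
theorem lastTame_smul_pi_pi (ρ : ℝ) : LastTame 1 ![ρ * Real.pi, Real.pi] :=
  lastTame_of_lastFed (lastFed_smul_pi_pi ρ)

/-- `(π, ρπ)` is FED by its first coordinate `π`. -/
theorem isFed_pi_smul_pi (ρ : ℝ) : IsFed 2 ![Real.pi, ρ * Real.pi] :=
  isFed_of_isAlgebraic_base_exp_coord_mul_I _ 0 (by simp [Real.pi_ne_zero])
    (by simpa using isAlgebraic_exp_pi_mul_I.tower_top (baseField ![Real.pi, ρ * Real.pi]))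

/-- `(π, ρπ)` is TAME. -/
theorem isTame_pi_smul_pi (ρ : ℝ) : IsTame 2 ![Real.pi, ρ * Real.pi] := isTame_of_isFed (isFed_pi_smul_pi ρ)

/-- `(π, ρπ)` is NOT WILD (so the W0-cells at it are vacuous). -/
theorem not_isWild_pi_smul_pi (ρ : ℝ) : ¬ IsWild 2 ![Real.pi, ρ * Real.pi] :=
  fun h => (isWild_iff_not_isTame _).1 h (isTame_pi_smul_pi ρ)

/-- `(π)` is a SHARP HYPERPLANE of `(π, ρπ)` (`t(π) ≤ 2`, tree `polarDeg_pi_le_two`). -/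
theorem hasSharpHyperplane_pi_smul_pi (ρ : ℝ) : HasSharpHyperplane 1 ![Real.pi, ρ * Real.pi] := by
  refine ⟨![Real.pi], linearIndependent_unique_iff.2 (by simp [Real.pi_ne_zero]), fun j => ?_,
    by simpa using polarDeg_pi_le_two⟩
  fin_cases j
  simpa using coord_mem_span ![Real.pi, ρ * Real.pi] 0

/-- `Fin.init (π, ρπ) = (π)` has `t(π) ≤ 2`: the sharp-init hypothesis of SRL-At / W0Init-At at `(π | ρπ)`
HOLDS (hypothesis-free; tree `polarDeg_pi_le_two`). -/
theorem polarDeg_init_pi_smul_pi_le (ρ : ℝ) :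
    polarDeg (Fin.init ![Real.pi, ρ * Real.pi]) ≤ ((1 + 1 : ℕ) : Cardinal) := by
  have h : Fin.init ![Real.pi, ρ * Real.pi] = ![Real.pi] := by
    funext i
    fin_cases i
    rfl
  rw [h]
  simpa using polarDeg_pi_le_two

/-- … so the SRL cell (item 32406) at `(π | ρπ)` is NOT vacuous: apart from `KleinIH 2` (= X strictly below), its
hypotheses ℚ-free and sharp-init are THEOREMS. -/
theorem sharpRelativeLindemannAt_pi_hypotheses {ρ : ℝ} (hρ : Irrational ρ) :
    LinearIndependent ℚ ![Real.pi, ρ * Real.pi] ∧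
      polarDeg (Fin.init ![Real.pi, ρ * Real.pi]) ≤ ((1 + 1 : ℕ) : Cardinal) :=
  ⟨linearIndependent_pi_smul_pi hρ, polarDeg_init_pi_smul_pi_le ρ⟩

/-! ### Separation from the earlier storey-two cells (hypothesis-free) -/

/-- **`π` is not a Liouville number** — hypothesis-free in the tree: the Nesterenko–Waldschmidt measure
`RootDecomp1KHyper.polyMeasure_pi` (PROVED) and Mahler's class principle
`RootDecomp1KHyper.algebraicIndependent_of_polyMeasure_liouville` would make `(π, π)` algebraically independent. -/
theorem not_liouville_pi : ¬ Liouville Real.pi := fun h =>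
  absurd ((Summit.Schanuel.Schanuel.Theorems.RootDecomp1KHyper.algebraicIndependent_of_polyMeasure_liouville
      Summit.Schanuel.Schanuel.Theorems.RootDecomp1KHyper.polyMeasure_pi h).injective
    (show (![(Real.pi : ℂ), ((Real.pi : ℝ) : ℂ)] : Fin 2 → ℂ) 0 = ![(Real.pi : ℂ), ((Real.pi : ℝ) : ℂ)] 1
      from rfl))
    (by decide)

/-- … hence not ultra-Liouville (nor hyper-Liouville). -/
theorem not_ultraLiouville_pi : ¬ UltraLiouville Real.pi := fun h => not_liouville_pi h.liouville

/-- NON-COSTUME w.r.t. the g30/g31 storey-two cells `(1 | u)`, `u` ultra-Liouville: the set `{π, ρπ}` is never of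
the form `{1, u}` with `u` ultra-Liouville (π ≠ 1, and `u = π` is excluded by `not_ultraLiouville_pi`). -/
theorem range_pi_smul_pi_ne_storey_one (ρ : ℝ) :
    ¬ ∃ u : ℝ, UltraLiouville u ∧ Set.range ![Real.pi, ρ * Real.pi] = Set.range ![(1 : ℝ), u] := by
  rintro ⟨u, hu, hset⟩
  have hπ : Real.pi ∈ Set.range ![(1 : ℝ), u] := hset ▸ ⟨0, rfl⟩
  obtain ⟨i, hi⟩ := hπ
  fin_cases i
  · have h1 : (1 : ℝ) = Real.pi := by simpa using hi
    linarith [Real.pi_gt_three]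
  · have h2 : u = Real.pi := by simpa using hi
    exact not_ultraLiouville_pi (h2 ▸ hu)

/-- NON-COSTUME w.r.t. the g32 / lens-2 E-LINE cells `ρ′·(γ₁, γ₂)` with an ALGEBRAIC frame `γ`: `(π, ρπ)` is on no
such line when `ρ` is ultra-Liouville (else `ρ = γ₂/γ₁` would be algebraic; Liouville numbers are transcendental —
tree `transcendental_ofReal_of_liouville`). -/
theorem pi_smul_pi_ne_algebraic_line {ρ : ℝ} (hρ : UltraLiouville ρ) :
    ¬ ∃ (ρ' γ₁ γ₂ : ℝ), IsAlgebraic ℚ ((γ₁ : ℝ) : ℂ) ∧ IsAlgebraic ℚ ((γ₂ : ℝ) : ℂ) ∧ γ₁ ≠ 0 ∧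
      ![Real.pi, ρ * Real.pi] = ![ρ' * γ₁, ρ' * γ₂] := by
  rintro ⟨ρ', γ₁, γ₂, h₁, h₂, hγ, heq⟩
  have e0 : Real.pi = ρ' * γ₁ := by simpa using congr_fun heq 0
  have e1 : ρ * Real.pi = ρ' * γ₂ := by simpa using congr_fun heq 1
  have hρ'0 : ρ' ≠ 0 := by
    rintro rfl
    exact Real.pi_ne_zero (by rw [zero_mul] at e0; exact e0)
  have hρeq : ρ = γ₂ / γ₁ := by
    field_simp
    have : ρ * (ρ' * γ₁) = ρ' * γ₂ := by rw [← e0]; exact e1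
    have h' : ρ' * (ρ * γ₁) = ρ' * γ₂ := by linear_combination this
    exact mul_left_cancel₀ hρ'0 h'
  have halg : IsAlgebraic ℚ ((ρ : ℝ) : ℂ) := by
    rw [hρeq, Complex.ofReal_div]
    exact h₂.mul h₁.inv
  exact Summit.Schanuel.Schanuel.Theorems.RootDecomp1KHyper.transcendental_ofReal_of_liouville hρ.liouville halg

/-! ### The step cells of the 1B route at these tuples -/

/-- **SRLAt (π | ρπ)** — the sharp relative Lindemann step of item 32406 AT `(π | ρπ)`, `ρ` ultra-Liouville:
its conclusion `t ≥ 3` holds (mod Cor. 5.2). -/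
theorem sharpRelativeLindemannAt_pi_ultra (h52 : NesterenkoPhilippon2001_ch3_cor_5_2) {ρ : ℝ}
    (hρ : UltraLiouville ρ) : SharpRelativeLindemannAt 1 ![Real.pi, ρ * Real.pi] :=
  fun _ _ _ => three_le_polarDeg_pi_ultra h52 hρ

/-- **SRLAt (ρπ | π)**. -/
theorem sharpRelativeLindemannAt_smul_pi_pi_ultra (h52 : NesterenkoPhilippon2001_ch3_cor_5_2) {ρ : ℝ}
    (hρ : UltraLiouville ρ) : SharpRelativeLindemannAt 1 ![ρ * Real.pi, Real.pi] :=
  fun _ _ _ => three_le_polarDeg_smul_pi_pi_ultra h52 hρ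

/-- **T0At (ρπ | π) — THE DECIDED TAME CELL** (item 32407 `TameDefectZeroStep` AT the re-based tuple, whose last
coordinate `π` is tame): the conclusion `t ≥ 4` holds outright (mod Cor. 5.2). -/
theorem tameDefectZeroAt_smul_pi_pi_ultra (h52 : NesterenkoPhilippon2001_ch3_cor_5_2) {ρ : ℝ}
    (hρ : UltraLiouville ρ) : TameDefectZeroAt 1 ![ρ * Real.pi, Real.pi] :=
  fun _ _ _ _ => four_le_polarDeg_smul_pi_pi_ultra h52 hρ

/-- … and this T0-cell is NOT vacuous: apart from `KleinIH 2` (= X strictly below), EVERY structural hypothesis of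
`TameDefectZeroAt 1 (ρπ | π)` is a theorem — ℚ-free, `LastTame`, and the floor `t ≥ 3`. -/
theorem tameDefectZeroAt_smul_pi_pi_hypotheses (h52 : NesterenkoPhilippon2001_ch3_cor_5_2) {ρ : ℝ}
    (hρ : UltraLiouville ρ) :
    LinearIndependent ℚ ![ρ * Real.pi, Real.pi] ∧ LastTame 1 ![ρ * Real.pi, Real.pi] ∧
      ((1 + 1 + 1 : ℕ) : Cardinal) ≤ polarDeg ![ρ * Real.pi, Real.pi] :=
  ⟨linearIndependent_smul_pi_pi hρ.irrational, lastTame_smul_pi_pi ρ, three_le_polarDeg_smul_pi_pi_ultra h52 hρ⟩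

/-- **T0At (π | ρπ)** — the conclusion holds outright here too (the last coordinate `ρπ` is not known to be tame;
the tuple is tame through `π`). -/
theorem tameDefectZeroAt_pi_ultra (h52 : NesterenkoPhilippon2001_ch3_cor_5_2) {ρ : ℝ}
    (hρ : UltraLiouville ρ) : TameDefectZeroAt 1 ![Real.pi, ρ * Real.pi] :=
  fun _ _ _ _ => four_le_polarDeg_pi_ultra h52 hρ

/-- **W0At (π | ρπ)** — item 32408 AT `(π | ρπ)`: holds (twice over: the conclusion is a theorem mod Cor. 5.2, and the
wildness hypothesis is refutable, `not_isWild_pi_smul_pi`). -/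
theorem wildSharpDefectZeroAt_pi_ultra (h52 : NesterenkoPhilippon2001_ch3_cor_5_2) {ρ : ℝ}
    (hρ : UltraLiouville ρ) : WildSharpDefectZeroAt 1 ![Real.pi, ρ * Real.pi] :=
  fun _ _ _ _ _ => four_le_polarDeg_pi_ultra h52 hρ

/-- W0At (π | ρπ) hypothesis-free, by vacuity (the tuple is tame). -/
theorem wildSharpDefectZeroAt_pi_smul_pi (ρ : ℝ) : WildSharpDefectZeroAt 1 ![Real.pi, ρ * Real.pi] :=
  fun _ _ hW _ _ => absurd hW (not_isWild_pi_smul_pi ρ)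

/-- **W0InitAt (π | ρπ)** — the coordinate form (sharp hyperplane `Fin.init r = (π)`). -/
theorem wildSharpDefectZeroInitAt_pi_ultra (h52 : NesterenkoPhilippon2001_ch3_cor_5_2) {ρ : ℝ}
    (hρ : UltraLiouville ρ) : WildSharpDefectZeroInitAt 1 ![Real.pi, ρ * Real.pi] :=
  fun _ _ _ _ _ => four_le_polarDeg_pi_ultra h52 hρ

/-- LIVE LINK (route 1K, item 33363 `HyperLiouvilleSchanuel`): its `n = 4` instance at the Klein-polar tuple
`z = (π, ρπ, iπ, iρπ)` in the item's verbatim binder shape — the conclusion holds outright (mod Cor. 5.2). -/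
theorem hyperLiouvilleSchanuel_instance_pi_ultra (h52 : NesterenkoPhilippon2001_ch3_cor_5_2) {ρ : ℝ}
    (hρ : UltraLiouville ρ) :
    LinearIndependent ℚ (Fin.append (fun j => ((![Real.pi, ρ * Real.pi] j : ℝ) : ℂ))
        (fun j => ((![Real.pi, ρ * Real.pi] j : ℝ) : ℂ) * Complex.I)) →
      (∀ m : ℕ, ∃ h : Fin (2 + 2) → ℤ, h ≠ 0 ∧
        ‖∑ i, (h i : ℂ) * (Fin.append (fun j => ((![Real.pi, ρ * Real.pi] j : ℝ) : ℂ))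
          (fun j => ((![Real.pi, ρ * Real.pi] j : ℝ) : ℂ) * Complex.I)) i‖ <
            Real.exp (-((1 + ∑ i, (|h i| : ℝ)) ^ m))) →
      ((2 + 2 : ℕ) : Cardinal) ≤ Algebra.trdeg ℚ ↥(IntermediateField.adjoin ℚ
        (Set.range (Fin.append (fun j => ((![Real.pi, ρ * Real.pi] j : ℝ) : ℂ))
            (fun j => ((![Real.pi, ρ * Real.pi] j : ℝ) : ℂ) * Complex.I)) ∪
          Set.range (Complex.exp ∘ Fin.append (fun j => ((![Real.pi, ρ * Real.pi] j : ℝ) : ℂ))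
            (fun j => ((![Real.pi, ρ * Real.pi] j : ℝ) : ℂ) * Complex.I)))) :=
  fun _ _ => four_le_polarDeg_pi_ultra h52 hρ

/-! ### Flagship, density, the named member `rhoU`, and the X ⟹ cell shape check -/

/-- **FLAGSHIP.** There is a real `ρ > 0`, irrational (indeed ultra-Liouville), with `(π, ρπ)` `ℚ`-free, TAME, over the
SHARP hyperplane `(π)`, and `t(π, ρπ) ≥ 4`: X(2) decided at a storey-two cell over a transcendental hyperplane
(mod Cor. 5.2). -/
theorem exists_storey_two_cell_pi (h52 : NesterenkoPhilippon2001_ch3_cor_5_2) :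
    ∃ ρ : ℝ, 0 < ρ ∧ Irrational ρ ∧ LinearIndependent ℚ ![Real.pi, ρ * Real.pi] ∧
      IsTame 2 ![Real.pi, ρ * Real.pi] ∧ HasSharpHyperplane 1 ![Real.pi, ρ * Real.pi] ∧
      ((2 + 2 : ℕ) : Cardinal) ≤ polarDeg ![Real.pi, ρ * Real.pi] := by
  obtain ⟨ρ, hρ0, hρ⟩ := exists_pos_ultraLiouville
  exact ⟨ρ, hρ0, hρ.irrational, linearIndependent_pi_smul_pi hρ.irrational, isTame_pi_smul_pi ρ,
    hasSharpHyperplane_pi_smul_pi ρ, four_le_polarDeg_pi_ultra h52 hρ⟩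

/-- … and such `ρ` are DENSE in `ℝ`. -/
theorem dense_storey_two_cells_pi (h52 : NesterenkoPhilippon2001_ch3_cor_5_2) :
    Dense {ρ : ℝ | ((2 + 2 : ℕ) : Cardinal) ≤ polarDeg ![Real.pi, ρ * Real.pi]} :=
  dense_setOf_ultraLiouville.mono fun _ hρ => four_le_polarDeg_pi_ultra h52 hρ

/-- THE NAMED CELL: `t(π, ρ_U π) ≥ 4` for the explicit ultra-Liouville real `rhoU = Σ_k 2^{−u_k}` of part 06. -/
theorem four_le_polarDeg_pi_rhoU (h52 : NesterenkoPhilippon2001_ch3_cor_5_2) :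
    ((2 + 2 : ℕ) : Cardinal) ≤ polarDeg ![Real.pi, rhoU * Real.pi] :=
  four_le_polarDeg_pi_ultra h52 ultraLiouville_rhoU

/-- The named cell in the verbatim shape of X's body (`m = 2`, `r = (π, ρ_U π)`). -/
theorem kleinPolarSchanuel_body_two_pi_rhoU (h52 : NesterenkoPhilippon2001_ch3_cor_5_2) :
    ((2 + 2 : ℕ) : Cardinal) ≤ Algebra.trdeg ℚ ↥(IntermediateField.adjoin ℚ
      (Set.range (Fin.append (fun j => ((![Real.pi, rhoU * Real.pi] j : ℝ) : ℂ))
          (fun j => ((![Real.pi, rhoU * Real.pi] j : ℝ) : ℂ) * Complex.I)) ∪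
        Set.range (Complex.exp ∘ Fin.append (fun j => ((![Real.pi, rhoU * Real.pi] j : ℝ) : ℂ))
          (fun j => ((![Real.pi, rhoU * Real.pi] j : ℝ) : ℂ) * Complex.I)))) :=
  four_le_polarDeg_pi_rhoU h52

/-- `(π, ρ_U π)` is `ℚ`-free. -/
theorem linearIndependent_pi_rhoU : LinearIndependent ℚ ![Real.pi, rhoU * Real.pi] :=
  linearIndependent_pi_smul_pi irrational_rhoU

/-- SHAPE CHECK (costume direction): X ⟹ the named cell, by instantiation (`m = 2`, `r = (π, ρ_U π)`). -/
theorem kleinPolarSchanuel_instance_pi_rhoU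
    (hX : Summit.Schanuel.Schanuel.Theses.RootDecomp1B.KleinPolarSchanuel) :
    ((2 + 2 : ℕ) : Cardinal) ≤ polarDeg ![Real.pi, rhoU * Real.pi] :=
  hX 2 ![Real.pi, rhoU * Real.pi] linearIndependent_pi_rhoU

end Cells

end Summit.Schanuel.Schanuel.Theorems.RootDecomp1BNesterenkoRadical

end
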